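/- Lead `ym-line-cbag-p1`, route `ColdBoxAllGroups`, crux `BoxFloorAllGroups` (stmt-QuantumFields-22254), line `birth`, stub S2, brick B8b
«GaussTailD»: the Gaussian mass of the bad event of the one-scale expansion in the exponential chart is exponentially small. -/
import Summits.QuantumFields.YangMills.Theorems.ColdBoxAllGroupsBoxFloorAllGroupsGaussSideD
import Summits.QuantumFields.YangMills.Theorems.ColdBoxAllGroupsBoxFloorAllGroupsTiltBoundG
import Summits.QuantumFields.YangMills.Theorems.WeakCouplingRatesColdBoxGaussTail
import Literature.MathematicalPhysics.QuantumFieldTheory.WilsonPlaquetteWeakCouplingFloor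

/-!
# Crux `BoxFloorAllGroups`, stub S2, brick B8b «GaussTailD»: the Gaussian small-field region lies inside the good event of the
# exponential-chart expansion, so `gaussD(Sᶜ) ≤ 240·D·(2H+1)⁴·e^{−R²/2}`

`G`-generic port of `WeakCouplingRatesColdBoxGaussTail` (`smallField_subset_goodT`, `gauss3_real_compl_goodT_le`).  The good event of the
exponential-chart representation is `S = goodTE ρ H β ε ∩ {t | ∀ e, ‖unscaleTE H D β t e‖ ≤ m}` (small plaquette costs of the chart
configuration AND chart coordinates inside the ball of radius `m` on which the chart is injective and the Haar density is controlled —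
unlike the gnomonic chart of `SU(2)` the exponential chart is not globally injective, so the ball condition is part of the event).
With `ρR = (12H²+2H+1)·R` (linear forest Poincaré `abs_dirGlue_le_of_sCirc_le`) and `m_E = √D·ρR/√β`:

* `norm_unscaleTE_le_of_smallField` — on the Gaussian small-field region `{∀ c p, |s_c(p)| ≤ R}` every chart coordinate has norm `≤ m_E`;
* `plaqCostAt_cfgTE_lt_of_smallField` — and every plaquette of `ℤ⁴` costs `≤ (D/2)R²/β + 190·m_E³` in `cfgTE ρ H β t` (`m_E ≤ 1/4`; cubic
  remainder `abs_qObsD_sub_beta_mul_plaqCostAt_le` + `qObsD_le_of_smallField`);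
* **`smallField_subset_goodTE_inter_ball`** — hence the small-field region lies inside `S` once `m_E ≤ m`, `m_E ≤ 1/4` and
  `(D/2)R²/β + 190·m_E³ < β^{2ε−1}`;
* **`gaussD_real_compl_goodTE_inter_ball_le`** — `gaussD(Sᶜ) ≤ 240·D·(2H+1)⁴·e^{−R²/2}` (`measureReal_gaussD_not_smallField_le`);
* `beta_mul_plaqCostAt_mem_Icc_of_mem_goodTE` — on `goodTE` the two centre plaquette costs satisfy `0 ≤ β·cost ≤ β^{2ε}` (`β ≥ 1`).
No sorry; no new definition; standard axioms.  NOT a claim about the mass gap (rung-level support, RECORD label).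
-/

set_option autoImplicit false

noncomputable section

open MeasureTheory Finset Real
open Literature.Probability.LatticeModels (Site)
open Literature.MathematicalPhysics.QuantumLattice
open Literature.MathematicalPhysics.QuantumFieldTheory
open Literature.MathematicalPhysics.QuantumFieldTheory.LatticeMaxwell
open Literature.MathematicalPhysics.QuantumFieldTheory.AxialGauge
open Summit.QuantumFields.YangMills.Theorems.WeakCouplingRates
open Summit.QuantumFields.YangMills.Theorems.FreeEnergyLogCoefficient

namespace Summit.QuantumFields.YangMills.Theorems.ColdBoxAllGroups

variable {N : ℕ} {G : Type*} [Group G] (ρ : G →* Matrix (Fin N) (Fin N) ℂ) {H : ℕ}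

/-! ## Chart coordinates on the Gaussian small-field region -/

/-- **Linear forest Poincaré, `D` colours**: if every Dirichlet circulation of every colour is at most `R` in absolute value then every chart
coordinate `unscaleTE H D β t e` has norm `≤ √D·(12H²+2H+1)·R/√β`. -/
theorem norm_unscaleTE_le_of_smallField {D : ℕ} {β R : ℝ} (hβ : 0 < β) (hH : 1 ≤ H) (hR : 0 ≤ R) (t : TSpaceD H D)
    (ht : ∀ c : Fin D, ∀ p : ZdPlaquette 4, |dirCirc H (p.1, p.2.1.1, p.2.1.2) (t c)| ≤ R) (e : ColdFreeIdx H) :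
    ‖unscaleTE H D β t e‖ ≤ Real.sqrt D * ((12 * (H : ℝ) ^ 2 + 2 * H + 1) * R) / Real.sqrt β := by
  set ρR : ℝ := (12 * (H : ℝ) ^ 2 + 2 * H + 1) * R with hρR
  have hρR0 : 0 ≤ ρR := by positivity
  have hsβ : 0 < Real.sqrt β := Real.sqrt_pos.2 hβ
  -- every glued edge value is at most `ρR`
  have hedge : ∀ (c : Fin D) (f : Literature.MathematicalPhysics.QuantumLattice.ZdEdge 4), |dirGlue H (WithLp.ofLp (t c)) f| ≤ ρR := by
    intro c f
    refine abs_dirGlue_le_of_sCirc_le hH (WithLp.ofLp (t c)) (fun x i j => ?_) f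
    exact abs_sCirc_le_of_forall_zdPlaquette _ hR (fun p => by rw [← dirCirc_apply]; exact ht c p) x i j
  -- each coordinate of `unscaleTE t e` is a glued edge value over `√β`
  have hcoord : ∀ i : Fin D, |unscaleTE H D β t e i| ≤ ρR / Real.sqrt β := by
    intro i
    have h := extZero_unscaleTE_apply D β t e.1.1 i
    rw [extZero_apply_free] at h
    rw [h, abs_div, abs_of_pos hsβ]
    exact div_le_div_of_nonneg_right (hedge i _) hsβ.le
  have hsq : ‖unscaleTE H D β t e‖ ^ 2 ≤ (Real.sqrt D * ρR / Real.sqrt β) ^ 2 := by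
    rw [EuclideanSpace.real_norm_sq_eq]
    have h := sum_sq_le_card_mul_sq (fun i => unscaleTE H D β t e i) hcoord
    have hD : Real.sqrt (D : ℝ) ^ 2 = D := Real.sq_sqrt (Nat.cast_nonneg _)
    calc ∑ i, unscaleTE H D β t e i ^ 2 ≤ (D : ℝ) * (ρR / Real.sqrt β) ^ 2 := h
      _ = (Real.sqrt D * ρR / Real.sqrt β) ^ 2 := by
          have e2 : (Real.sqrt D * ρR / Real.sqrt β) ^ 2 = Real.sqrt D ^ 2 * (ρR / Real.sqrt β) ^ 2 := by ring
          rw [e2, hD]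
  have h0 : 0 ≤ Real.sqrt D * ρR / Real.sqrt β := by positivity
  exact (pow_le_pow_iff_left₀ (norm_nonneg _) h0 two_ne_zero).1 hsq

section Chart

variable [TopologicalSpace G] [CompactSpace G]

/-- **Plaquette costs on the Gaussian small-field region.**  For continuous unitary-valued `ρ`, `β > 0`, if every Dirichlet circulation of
every colour of `t` is at most `R` and `m_E = √D(12H²+2H+1)R/√β ≤ 1/4` (`D = dimE ρ`), then every plaquette `(x,i,j)` of `ℤ⁴` costs
`≤ (D/2)·R²/β + 190·m_E³` in the chart configuration `cfgTE ρ H β t`. -/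
theorem plaqCostAt_cfgTE_le_of_smallField (hρ : Continuous ρ) {β R : ℝ} (hβ : 0 < β) (hH : 1 ≤ H) (hR : 0 ≤ R)
    (hmE : Real.sqrt (dimE ρ) * ((12 * (H : ℝ) ^ 2 + 2 * H + 1) * R) / Real.sqrt β ≤ 1 / 4) (t : TSpaceD H (dimE ρ))
    (ht : ∀ c : Fin (dimE ρ), ∀ p : ZdPlaquette 4, |dirCirc H (p.1, p.2.1.1, p.2.1.2) (t c)| ≤ R) (x : Site 4) (i j : Fin 4) :
    plaqCostAt ρ x i j (cfgTE ρ H β t) ≤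
      (dimE ρ : ℝ) / 2 * R ^ 2 / β + 190 * (Real.sqrt (dimE ρ) * ((12 * (H : ℝ) ^ 2 + 2 * H + 1) * R) / Real.sqrt β) ^ 3 := by
  set mE : ℝ := Real.sqrt (dimE ρ) * ((12 * (H : ℝ) ^ 2 + 2 * H + 1) * R) / Real.sqrt β with hmEdef
  have hmE0 : 0 ≤ mE := by positivity
  have hlink : ∀ e, ‖unscaleTE H (dimE ρ) β t e‖ ≤ mE := norm_unscaleTE_le_of_smallField hβ hH hR t ht
  have hcub := abs_qObsD_sub_beta_mul_plaqCostAt_le ρ hρ hβ hmE0 hmE t hlink x i j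
  have hq : qObsD H (dimE ρ) (x, i, j) t ≤ (dimE ρ : ℝ) / 2 * R ^ 2 :=
    qObsD_le_of_smallField _ t fun c => abs_sCirc_le_of_forall_zdPlaquette _ hR (fun p => by rw [← dirCirc_apply]; exact ht c p) x i j
  have h2 := (abs_le.1 hcub).1
  -- `β·cost ≤ qObsD + 190βm³`, divide by `β`
  have hβcost : β * plaqCostAt ρ x i j (cfgTE ρ H β t) ≤ (dimE ρ : ℝ) / 2 * R ^ 2 + β * (190 * mE ^ 3) := by linarith
  have : plaqCostAt ρ x i j (cfgTE ρ H β t) ≤ ((dimE ρ : ℝ) / 2 * R ^ 2 + β * (190 * mE ^ 3)) / β := by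
    rw [le_div_iff₀ hβ]; linarith
  refine this.trans (le_of_eq ?_)
  field_simp

/-- **The Gaussian small-field region lies inside the good event `S = goodTE ∩ ball(m)`** once `m_E ≤ m`, `m_E ≤ 1/4` and
`(D/2)R²/β + 190·m_E³ < β^{2ε−1}` (`m_E = √D(12H²+2H+1)R/√β`). -/
theorem smallField_subset_goodTE_inter_ball (hρ : Continuous ρ) {β ε R m : ℝ} (hβ : 0 < β) (hH : 1 ≤ H) (hR : 0 ≤ R)
    (hmE : Real.sqrt (dimE ρ) * ((12 * (H : ℝ) ^ 2 + 2 * H + 1) * R) / Real.sqrt β ≤ 1 / 4)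
    (hmEm : Real.sqrt (dimE ρ) * ((12 * (H : ℝ) ^ 2 + 2 * H + 1) * R) / Real.sqrt β ≤ m)
    (hwin : (dimE ρ : ℝ) / 2 * R ^ 2 / β + 190 * (Real.sqrt (dimE ρ) * ((12 * (H : ℝ) ^ 2 + 2 * H + 1) * R) / Real.sqrt β) ^ 3 <
      β ^ (2 * ε - 1)) :
    {t : TSpaceD H (dimE ρ) | ∀ c : Fin (dimE ρ), ∀ p : ZdPlaquette 4, |dirCirc H (p.1, p.2.1.1, p.2.1.2) (t c)| ≤ R} ⊆
      goodTE ρ H β ε ∩ {t | ∀ e, ‖unscaleTE H (dimE ρ) β t e‖ ≤ m} := by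
  intro t ht
  simp only [Set.mem_setOf_eq] at ht
  refine ⟨?_, fun e => (norm_unscaleTE_le_of_smallField hβ hH hR t ht e).trans hmEm⟩
  rw [mem_goodTE_iff, mem_coldGoodSetG_iff]
  intro p _
  exact (plaqCostAt_cfgTE_le_of_smallField ρ hρ hβ hH hR hmE t ht p.1 p.2.1.1 p.2.1.2).trans_lt hwin

/-- **The Gaussian mass of the bad event is exponentially small**: under the window of `smallField_subset_goodTE_inter_ball`,
`gaussD((goodTE ∩ ball(m))ᶜ) ≤ 240·D·(2H+1)⁴·e^{−R²/2}`. -/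
theorem gaussD_real_compl_goodTE_inter_ball_le (hρ : Continuous ρ) {β ε R m : ℝ} (hβ : 0 < β) (hH : 1 ≤ H) (hR : 0 ≤ R)
    (hmE : Real.sqrt (dimE ρ) * ((12 * (H : ℝ) ^ 2 + 2 * H + 1) * R) / Real.sqrt β ≤ 1 / 4)
    (hmEm : Real.sqrt (dimE ρ) * ((12 * (H : ℝ) ^ 2 + 2 * H + 1) * R) / Real.sqrt β ≤ m)
    (hwin : (dimE ρ : ℝ) / 2 * R ^ 2 / β + 190 * (Real.sqrt (dimE ρ) * ((12 * (H : ℝ) ^ 2 + 2 * H + 1) * R) / Real.sqrt β) ^ 3 <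
      β ^ (2 * ε - 1)) :
    (gaussD H (dimE ρ)).real (goodTE ρ H β ε ∩ {t | ∀ e, ‖unscaleTE H (dimE ρ) β t e‖ ≤ m})ᶜ ≤
      240 * (dimE ρ) * (2 * (H : ℝ) + 1) ^ 4 * Real.exp (-R ^ 2 / 2) :=
  (measureReal_mono (Set.compl_subset_compl.2 (smallField_subset_goodTE_inter_ball ρ hρ hβ hH hR hmE hmEm hwin))).trans
    (measureReal_gaussD_not_smallField_le H (dimE ρ) hR)

end Chart

/-! ## The observables on the good event -/

/-- **On `goodTE` the two centre plaquettes cost at most `β^{2ε−1}`**, hence `0 ≤ β·cost ≤ β^{2ε}` (`β ≥ 1`, unitary `ρ`). -/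
theorem beta_mul_plaqCostAt_mem_Icc_of_mem_goodTE (hρu : ∀ g, ρ g ∈ Matrix.unitaryGroup (Fin N) ℂ) {β ε : ℝ} (hβ : 1 ≤ β)
    {t : TSpaceD H (dimE ρ)} (ht : t ∈ goodTE ρ H β ε) {p : ZdPlaquette 4} (hp : p ∈ plaquettesTouching (boxEdges 4 (2 * H + 1))) :
    0 ≤ β * plaqCostAt ρ p.1 p.2.1.1 p.2.1.2 (cfgTE ρ H β t) ∧ β * plaqCostAt ρ p.1 p.2.1.1 p.2.1.2 (cfgTE ρ H β t) ≤ β ^ (2 * ε) := by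
  have hβ0 : 0 < β := by linarith
  rw [mem_goodTE_iff, mem_coldGoodSetG_iff] at ht
  have hlt := ht p hp
  have hnn : 0 ≤ plaqCostAt ρ p.1 p.2.1.1 p.2.1.2 (cfgTE ρ H β t) := by
    simp only [plaqCostAt, plaquetteObs]
    rw [Literature.MathematicalPhysics.QuantumFieldTheory.sub_re_trace_eq_half_norm_sub_one_sq (hρu _)]
    positivity
  refine ⟨mul_nonneg hβ0.le hnn, ?_⟩
  have hs : β * β ^ (2 * ε - 1) = β ^ (2 * ε) := by
    rw [show β * β ^ (2 * ε - 1) = β ^ (1 : ℝ) * β ^ (2 * ε - 1) by rw [Real.rpow_one], ← Real.rpow_add hβ0]; ring_nf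
  calc β * plaqCostAt ρ p.1 p.2.1.1 p.2.1.2 (cfgTE ρ H β t) ≤ β * β ^ (2 * ε - 1) := mul_le_mul_of_nonneg_left hlt.le hβ0.le
    _ = β ^ (2 * ε) := hs

end Summit.QuantumFields.YangMills.Theorems.ColdBoxAllGroups

end
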